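import Literature.Geometry.Lorentzian.CoordWeyl
import HarnessLib

/-!
# The curvature of a conformal metric (Besse 1.159 (b)) and the conformal invariance of the
# Weyl endomorphism, for metric components

Continuation of `ConformalCoordCurvature.lean` and `CoordWeyl.lean` (namespace `MetricCoord`:
components `G : E → (E →L E →L ℝ)` of a pseudo-Riemannian metric on a finite-dimensional real normed
space `E`, `m = dim E`, smooth, symmetric and nondegenerate on an open set `V` (`IsMetricOn G V`);
for a smooth nowhere-vanishing `c` on `V` the conformal components `G' = c · G` with conformal
one-form `θ = dc/(2c)` (`confForm`; `θ = df` for `c = e^{2f}`), conformal vector `T = θ♯`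
(`confVec`), covariant Hessian `H = ∇θ` (`confHess`), and the laws already proved there:
`Γ'` (1.159 (a)), `R'` uncontracted (`riemAt_conformal_apply`), `Ric'` (1.159 (d)),
`S'` (1.159 (f)); the Weyl endomorphism `weylAt` of `CoordWeyl.lean`). Everything here is PROVED;
no definition, no statement of `Prop` type.

* `weylAt_smul_left/right`, `weylAt_add_left/right` — `W(X,Y)` is bilinear in `(X, Y)`;
* (a private copy of) `MetricCoord.IsMetricOn.apply_riemAt_conformal` (PUBLIC in
  `ConformalChangeFour.lean`, landed concurrently) — **Besse 1987, Thm. 1.159 (b)**, the curvature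
  of a conformal metric, lowered with `G`:
  `G(R'(X,Y)Z, U) = G(R(X,Y)Z, U) − [B(Y,Z)G(X,U) − B(X,Z)G(Y,U) + G(Y,Z)B(X,U) − G(X,Z)B(Y,U)]`
  with the symmetric bilinear form `B = H − θ ⊗ θ + ½|θ|² G` (`|θ|² = θ(T)`), i.e.
  `R' = e^{2f}(R − g ⊙ (∇df − df∘df + ½|df|² g))` read through `g' = e^{2f} g` in the slot
  convention `Rm(X,Y,Z,U) = g(R(X,Y)Z,U)` of this tree (from `riemAt_conformal_apply` by metric
  compatibility, torsion-freeness, `G(∂T, ·) = Dθ − ∂G(T,·)` and the symmetry of `H`);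
* `IsMetricOn.apply_weylAt_conformal`, `IsMetricOn.weylAt_conformal` — **the Weyl endomorphism
  is conformally invariant**: `W'(X,Y)Z = W(X,Y)Z` for `m ≥ 3` (Besse 1987, Thm. 1.159: "`W`,
  considered as a `(3,1)`-tensor [sic: `(1,3)`], is conformally invariant"; combine (b) with the
  Ricci and scalar laws (d), (f) and `♯' = c⁻¹♯`);
* `IsMetricOn.conformal_apply_weylAt_conformal` — lowered with the NEW metric:
  `G'(W'(X,Y)Z, U) = c · G(W(X,Y)Z, U)`, i.e. `W' = e^{2f} W` as `(0,4)`-tensors; in a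
  `g`-orthonormal frame `e` the frame `e/√c` is `g'`-orthonormal and
  `W'(e/√c) = c⁻¹ W(e)`, `|W'|²_{g'} = c⁻² |W|²_g` — for `c = u²` in dimension four
  `|W_{u²g}| = u⁻²|W_g|`, the pointwise half of the conformal invariance of `∫|W|² dμ` and of
  `∫|W⁺|² dμ` used by Gursky–LeBrun 1999, §3 ("the `L²` norm of `W⁺` is conformally invariant").

## References

* A. L. Besse, *Einstein manifolds*, Springer 1987, Thm. 1.159 (a), (b), (d), (f) and the
  conformal invariance of `W`. [Besse1987]
* M. J. Gursky, C. LeBrun, Ann. Global Anal. Geom. 17 (1999) 315–328 (arXiv:math/9807055), §3.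
  [GurskyLebrun1999]
-/

noncomputable section

set_option maxSynthPendingDepth 3

open Set Filter ContinuousLinearMap Module
open scoped Topology ContDiff

namespace Literature.Geometry.Lorentzian

namespace MetricCoord

variable {E : Type*} [NormedAddCommGroup E] [NormedSpace ℝ E] [FiniteDimensional ℝ E]
  [CompleteSpace E] {G : E → E →L[ℝ] E →L[ℝ] ℝ} {V : Set E} {x : E} {c : E → ℝ}

/-! ### Linearity of the Weyl endomorphism in its first two slots -/

section Linearity

variable (G)

omit [CompleteSpace E] in
/-- `W(X,Y)` is homogeneous in `X`. [folklore] -/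
theorem weylAt_smul_left (x : E) (a : ℝ) (X Y : E) :
    weylAt G x (a • X) Y = a • weylAt G x X Y := by
  ext Z
  simp only [weylAt_apply, riemAt_smul_left, map_smul, _root_.smul_apply, smul_eq_mul,
    smul_sub, smul_add, smul_smul]
  module

omit [CompleteSpace E] in
/-- `W(X,Y)` is homogeneous in `Y`. [folklore] -/
theorem weylAt_smul_right (x : E) (a : ℝ) (X Y : E) :
    weylAt G x X (a • Y) = a • weylAt G x X Y := by
  rw [weylAt_swap, weylAt_smul_left, ← smul_neg, ← weylAt_swap]

omit [CompleteSpace E] in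
/-- `W(X,Y)` is additive in `X`. [folklore] -/
theorem weylAt_add_left (x X₁ X₂ Y : E) :
    weylAt G x (X₁ + X₂) Y = weylAt G x X₁ Y + weylAt G x X₂ Y := by
  ext Z
  simp only [weylAt_apply, riemAt_add_left, map_add, _root_.add_apply, smul_add, add_smul]
  module

omit [CompleteSpace E] in
/-- `W(X,Y)` is additive in `Y`. [folklore] -/
theorem weylAt_add_right (x X Y₁ Y₂ : E) :
    weylAt G x X (Y₁ + Y₂) = weylAt G x X Y₁ + weylAt G x X Y₂ := by
  rw [weylAt_swap, weylAt_add_left, neg_add, ← weylAt_swap, ← weylAt_swap]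

end Linearity

/-! ### Besse 1.159 (b) and the conformal invariance of `W` -/

set_option maxHeartbeats 1600000 in
/-- **The curvature of a conformal metric, Besse 1987, Thm. 1.159 (b)**, lowered with `G` — a
PRIVATE copy, in the term order used below, of
`MetricCoord.IsMetricOn.apply_riemAt_conformal` of `ConformalChangeFour.lean` (landed concurrently;
that public theorem is the one to cite and use; it is not imported here to keep this file within the
Fréchet-calculus layer): with `B(v,w) = H(v,w) − θ(v)θ(w) + ½ θ(T) G(v,w)`,
`G(R'(X,Y)Z, U) = G(R(X,Y)Z, U) − [B(Y,Z)G(X,U) − B(X,Z)G(Y,U) + G(Y,Z)B(X,U) − G(X,Z)B(Y,U)]`.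
[cite: Besse1987, Thm. 1.159 (b)] -/
private theorem IsMetricOn.apply_riemAt_conformal_aux (hG : IsMetricOn G V) (hc : ContDiffOn ℝ ∞ c V)
    (hc0 : ∀ y ∈ V, c y ≠ 0) (hx : x ∈ V) (X Y Z U : E) :
    G x (riemAt (fun y ↦ c y • G y) x X Y Z) U =
      G x (riemAt G x X Y Z) U
        - ((confHess G c x Y Z - confForm c x Y * confForm c x Z
              + (1 / 2 : ℝ) * confForm c x (confVec G c x) * G x Y Z) * G x X U
            - (confHess G c x X Z - confForm c x X * confForm c x Z
              + (1 / 2 : ℝ) * confForm c x (confVec G c x) * G x X Z) * G x Y U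
            + G x Y Z * (confHess G c x X U - confForm c x X * confForm c x U
              + (1 / 2 : ℝ) * confForm c x (confVec G c x) * G x X U)
            - G x X Z * (confHess G c x Y U - confForm c x Y * confForm c x U
              + (1 / 2 : ℝ) * confForm c x (confVec G c x) * G x Y U)) := by
  have hi := hG.isInvertible x hx
  have hs := hG.symm x hx
  have hΓ := hG.chrAt_comm hx
  -- `∂_vθ(w) = H(v,w) + θ(Γ(v,w))`
  have hθ' : ∀ v w, fderiv ℝ (confForm c) x v w =
      confHess G c x v w + confForm c x (chrAt G x v w) := by
    intro v w; rw [confHess_apply]; ring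
  have hHs : ∀ v w, confHess G c x v w = confHess G c x w v := by
    intro v w
    rw [confHess_apply, confHess_apply, hG.fderiv_confForm_comm hc hc0 hx v w, hΓ v w]
  rw [hG.riemAt_conformal_apply hc hc0 hx X Y Z]
  simp only [confDiff, map_add, map_sub, map_smul, _root_.add_apply, _root_.sub_apply,
    _root_.smul_apply, smul_eq_mul, hG.apply_fderiv_confVec hc hc0 hx, apply_confVec hi,
    hG.fderiv_eq_chrAt hx, hθ']
  -- symmetric normal forms of the atoms, then a polynomial identity
  simp only [hs _ (confVec G c x), apply_confVec hi]
  rw [hΓ Y X]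
  simp only [hs (chrAt G x X Y) Z, hs (chrAt G x X Z) U, hs (chrAt G x Y Z) U, hs (chrAt G x X Y) U,
    hs Z U, hs Y U, hs X U, hs Y Z, hs X Z, hs X Y, hHs Y X]
  ring

set_option maxHeartbeats 1600000 in
/-- **The Weyl endomorphism is conformally invariant** (Besse 1987, Thm. 1.159: `W` as a
`(1,3)`-tensor is unchanged under `g ↦ e^{2f} g`), lowered with the old metric: for `G' = c · G`
and `m = dim E ≥ 3`, `G(W'(X,Y)Z, U) = G(W(X,Y)Z, U)`. Proof: expand both Weyl endomorphisms
(`weylAt_apply`), insert (b) (Besse 1.159 (b), `apply_riemAt_conformal` of `ConformalChangeFour.lean`,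
private copy here), (d) (`ricAt_conformal`), (f)
(`scalAt_conformal`) and `♯' = c⁻¹♯` (`sharpAt_conformal`); the Hessian, `θ ⊗ θ` and `|θ|²` terms
cancel identically. [cite: Besse1987, Thm. 1.159] -/
theorem IsMetricOn.apply_weylAt_conformal (hG : IsMetricOn G V) (hc : ContDiffOn ℝ ∞ c V)
    (hc0 : ∀ y ∈ V, c y ≠ 0) (hx : x ∈ V) (hm : 3 ≤ Module.finrank ℝ E) (X Y Z U : E) :
    G x (weylAt (fun y ↦ c y • G y) x X Y Z) U = G x (weylAt G x X Y Z) U := by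
  have hi := hG.isInvertible x hx
  have hi' := (isMetricOn_conformal hG hc hc0).isInvertible x hx
  have hcx := hc0 x hx
  have hs := hG.symm x hx
  have h3 : (3 : ℝ) ≤ Module.finrank ℝ E := by exact_mod_cast hm
  have hm2 : (Module.finrank ℝ E : ℝ) - 2 ≠ 0 := by linarith
  have hm1 : (Module.finrank ℝ E : ℝ) - 1 ≠ 0 := by linarith
  rw [weylAt_apply, weylAt_apply]
  simp only [map_add, map_sub, map_smul, _root_.add_apply, _root_.sub_apply, _root_.smul_apply,
    smul_eq_mul, sharpAt_conformal hi hi' hcx, apply_sharpAt_apply hi,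
    hG.ricAt_conformal hc hc0 hx, hG.scalAt_conformal hc hc0 hx,
    hG.apply_riemAt_conformal_aux hc hc0 hx]
  simp only [hs Y U, hs X U, hs Y Z, hs X Z]
  field_simp
  ring

/-- **`W' = W`** as endomorphisms: for `G' = c · G` on `V` and `m ≥ 3`,
`weylAt (c · G) x X Y = weylAt G x X Y` at every `x ∈ V` (nondegeneracy of `G_x`).
[cite: Besse1987, Thm. 1.159] -/
theorem IsMetricOn.weylAt_conformal (hG : IsMetricOn G V) (hc : ContDiffOn ℝ ∞ c V)
    (hc0 : ∀ y ∈ V, c y ≠ 0) (hx : x ∈ V) (hm : 3 ≤ Module.finrank ℝ E) (X Y : E) :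
    weylAt (fun y ↦ c y • G y) x X Y = weylAt G x X Y := by
  ext Z
  have h0 : G x (weylAt (fun y ↦ c y • G y) x X Y Z - weylAt G x X Y Z) = 0 := by
    ext U
    rw [map_sub, _root_.sub_apply, hG.apply_weylAt_conformal hc hc0 hx hm X Y Z U, sub_self,
      _root_.zero_apply]
  exact sub_eq_zero.1 (eq_zero_of_forall_apply_eq_zero (hG.isInvertible x hx)
    fun U ↦ by rw [h0, _root_.zero_apply])

/-- **`W' = e^{2f} W` as `(0,4)`-tensors**: lowered with the NEW metric `G' = c · G`,
`G'(W'(X,Y)Z, U) = c · G(W(X,Y)Z, U)` (`m ≥ 3`). In a `G_x`-orthonormal frame `e` the frame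
`e/√c` is `G'_x`-orthonormal, so the orthonormal-frame components scale as `W'(e/√c) = c⁻¹ W(e)`
and `|W'|²_{G'} = c⁻²|W|²_G`: for `c = u²` in dimension four `|W_{u²g}| = u⁻²|W_g|`, the pointwise
half of the conformal invariance of `∫|W|² dμ` (with `dμ' = u⁴ dμ`, `ConformalVolume.lean`).
[cite: Besse1987, Thm. 1.159] [cite: GurskyLebrun1999, §3, proof of Theorem 1] -/
theorem IsMetricOn.conformal_apply_weylAt_conformal (hG : IsMetricOn G V)
    (hc : ContDiffOn ℝ ∞ c V) (hc0 : ∀ y ∈ V, c y ≠ 0) (hx : x ∈ V)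
    (hm : 3 ≤ Module.finrank ℝ E) (X Y Z U : E) :
    (fun y ↦ c y • G y) x (weylAt (fun y ↦ c y • G y) x X Y Z) U =
      c x * G x (weylAt G x X Y Z) U := by
  rw [conformal_apply, hG.weylAt_conformal hc hc0 hx hm X Y]

end MetricCoord

end Literature.Geometry.Lorentzian

end
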